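import Literature.MathematicalPhysics.QuantumFieldTheory.Balaban1983to89.B9Ineq363L2Right

/-!
# `Balaban1983to89.B9Ineq363L2Mixed` — [B9] (3.63)∕(3.65) IN THE `L²` NORMS OF THEOREM 3.1 (3.46), THE MIXED MEMBER: the left composite AT THE LETTER ∇,
# `∇_kG′(U)·V′(A)` (weight `(Lʲη)⁻¹`), and ★★ the mixed entry `∇_kG′(U′U)∇♯_l = ∇_kG′(U)∇♯_l + (∇_kG′(U)V′)·(G′(U′U)∇♯_l)` — one composition on top of
# the right entries of `B9Ineq363L2Right` (sequel on the ℓ²-block route of Sect. B; pub-ymgap N06 row 13)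

T. Bałaban, *Propagators for lattice gauge theories in a background field*, Commun. Math. Phys. **99** (1985) 389–434
[`Balaban1985BackgroundPropagators`, "B9"]; [4] = T. Bałaban, *Propagators and renormalization transformations for lattice gauge theories. II*,
Commun. Math. Phys. **96** (1984) 223–250 [`Balaban1984PropagatorsII`].

statement-level skeleton of published theorems with citation tags; proofs where landed; nothing here is a claim about the Yang–Mills mass gap

THE PRINTED LOCUS (verbatim).  Theorem 3.1 (3.46) p. 398: *"‖hG′(U)λ‖, ‖h∇_UG′(U)λ‖, ‖hG′(U)∇*_Uλ‖, ‖h∇_UG′(U)∇*_Uλ‖, … ≤ B₀[(Lʲη)², Lʲη, Lʲη, 1, …]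
|h|e^{−δ₀d(y,y′)}‖λ‖"*; p. 403 l. 1–9: *"applying Theorem 3.1 for G′(U), the bound (3.63), the representation (3.64) and Lemma 2.1 of [4] we can prove all
the statements (3.42)–(3.47) of Theorem 3.1 for the operator G′(U′U), of course with different constants"*.

WHAT IS IN THE FILE (theorems only; 0 sorry; standard axioms).  §1 `hasL2Majorant_DGV_of_divForm_sum_l2`, `hasL2Majorant_DGV_of_gradForm_comm_sum_l2` —
the device of `B9Ineq363L2Right` §2 with `G` replaced by a one-difference letter (`∇G′ ≺₂ B₀Lʲη e^{−δd}`, `∇G′∇♯_l ≺₂ B₀e^{−δd}`; output weight `(Lʲη)⁻¹`).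
§2 ★ `hasL2Majorant_dgp_vPrime` — `∇_kG′(U)·conj b V′(A) ≺₂ θ_R·(Lʲη)⁻¹·e^{−ρd}` for the CONCRETE `V′(A)` of (3.60), same explicit `θ_R` as
`B9Ineq363L2Right.hasL2Majorant_gp_vPrime`, from the `L²` members (3.46)₁ and (3.46)₄ at U.  §3 ★★ `hasL2Majorant_mixedEntry_gpExt` — `X·G′(U′U)·Y ≺₂
(B + θ′B′Λc₁(β))·e^{−ρd}` from `X·G′(U)·Y ≺₂ Be^{−δd}`, `X·G′(U)·V′ ≺₂ θ′(Lʲη)⁻¹e^{−δd}`, the right entry `G′(U′U)·Y ≺₂ B′Lʲη e^{−ρd}` and (3.65)₁ (one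
composition `B9Ineq363L2.hasL2Majorant_comp_decay`, the weight `(Lʲη)⁻¹·Lʲη = 1` after one p. 398 transfer; no further walk, no smallness).

HONEST SCOPE.  Finite-dimensional bookkeeping over r06's concrete letters; propagator inputs ((3.46) at U, the inverse identities, the right entry of
`G′(U′U)`) are hypotheses OF THE PRINTED SHAPE; nothing of [B9] asserted for Bałaban's propagators; count-neutral; NOT a node discharge; nothing
continuum ∕ OS ∕ mass-gap ∕ Clay.  Cell `pub-ymgap` (HUMAN RULING D-0062), Track A node N06 [B9], N06-ASSIGNMENT row 13, seat `pub-ymgap-dag-n06-c` (g4),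
2026-08-27.  RELATED, NOT DUPLICATED: `B9Ineq363L2Right` (the `G` device, sup twins listed there), `B9Ineq346L2Uniform` (r06's kernel-form route).
-/

noncomputable section

open scoped BigOperators

namespace Literature.MathematicalPhysics.QuantumFieldTheory.Balaban1983to89.B9Ineq363L2Mixed

open Literature.MathematicalPhysics.QuantumFieldTheory.Balaban1983to89
open Literature.MathematicalPhysics.QuantumFieldTheory.Balaban1983to89.B6RandomWalk (Triangle254 Ineq261)
open Literature.MathematicalPhysics.QuantumFieldTheory.Balaban1983to89.B6RandomWalkL2 (l2n HasL2Majorant hasL2Majorant_mono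
  hasL2Majorant_add hasL2Majorant_mul)
open Literature.MathematicalPhysics.QuantumFieldTheory.Balaban1983to89.B9Thm34Ext (toB6)
open Literature.MathematicalPhysics.QuantumFieldTheory.Balaban1983to89.B9Ineq347 (ScaleTransfer)
open Literature.MathematicalPhysics.QuantumFieldTheory.Balaban1983to89.B9Eq39Adjoint (covD covDstar)
open Literature.MathematicalPhysics.QuantumFieldTheory.Balaban1983to89.B9Eq352DivFormLetters (conj conj_sub conj_neg
  mulLetter gradLetterF gradLetterB commLetterF commLetterB mul_grad_comm_F mul_grad_comm_B norm_commLetterF_le norm_commLetterB_le)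
open Literature.MathematicalPhysics.QuantumFieldTheory.Balaban1983to89.B9Eq352DivForm (tauB)
open Literature.MathematicalPhysics.QuantumFieldTheory.Balaban1983to89.B9Eq352GradLetters (coefLetter diffLetter V0op V1pOp
  coefLetter_inl coefLetter_inr diffLetter_inl diffLetter_inr conj_V1pOp_eq_divForm)
open Literature.MathematicalPhysics.QuantumFieldTheory.Balaban1983to89.B9Eq360VprimeLetters (vPrimeConc vPrimeConc_eq avgOp)
open Literature.MathematicalPhysics.QuantumFieldTheory.Balaban1983to89.B9Ineq386CommSum (divForm_of_gradForm_sum)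
open Literature.MathematicalPhysics.QuantumFieldTheory.Balaban1983to89.B9Ineq361L2Letters (hasL2Majorant_conj_of_local
  hasL2Majorant_coefLetter hasL2Majorant_V0_vPrime hasL2Majorant_neg hasL2Majorant_sub)
open Literature.MathematicalPhysics.QuantumFieldTheory.Balaban1983to89.B9Ineq363L2 (hasL2Majorant_finsetSum
  hasL2Majorant_sum_const hasL2Majorant_rate_mono hasL2Majorant_comp_decay cVL2 cVL2_nonneg)
open Literature.MathematicalPhysics.QuantumFieldTheory.Balaban1983to89.B9Ineq363L2Right (hasL2Majorant_comm_coefLetter_diffLetter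
  hasL2Majorant_C₃_of_comm_sum_l2)

/-! ## §1  `∇_kG′(U)·V` in block-ℓ² form (the left composite at the letter ∇, weight `(Lʲη)⁻¹`) -/

section Abstract

variable {g : B9.Geometry} [Fintype g.Site] {R : ℝ} {H : Prop} {W : Type} [Fintype W] {K : Type}

/-- **`∇_kG′(U)·V ≺₂ B₀Λc₁(β)(Σc_B + c_V)·α₁·(Lʲη)⁻¹·e^{−ρd}` FROM THE DIVERGENCE FORM, IN ℓ²** — the device of
`B9Ineq363L2Right.hasL2Majorant_GV_of_divForm_sum_l2` with `G` replaced by a ONE-DIFFERENCE letter `∇_kG′(U)` (Theorem 3.1's members (3.46)₁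
`∇G′ ≺₂ B₀Lʲη e^{−δd}` and (3.46)₄ `∇G′∇♯ ≺₂ B₀e^{−δd}` at U): the words `(∇G′∇♯_l)B_l`, `(∇G′)C₃` carry the weight `(Lʲη)⁻¹` at the output block.
[cite: Balaban1985BackgroundPropagators, (3.46) p.398 + (3.61)–(3.63) p.402 + (3.70)–(3.73) pp.404–405 + p.398 (remarks) + p.403 l.1–9; Balaban1984PropagatorsII, Lemma 2.1 p.234 + (2.52)–(2.55) p.232 + Prop. 2.6 (2.140)–(2.141) p.247] -/
theorem hasL2Majorant_DGV_of_divForm_sum_l2 (blk : W → g.Site) (d : ℕ) (s : Finset K)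
    (δ₀ δ α β ρ Λ B₀ cV α₁ : ℝ) (cB : K → ℝ)
    (hB₀ : 0 ≤ B₀) (hcV : 0 ≤ cV) (hα₁ : 0 ≤ α₁) (hΛ : 0 ≤ Λ) (hρ : 0 ≤ ρ) (hα : 0 ≤ α) (hβ : 0 ≤ β) (hδ₀ : 0 ≤ δ₀)
    (hr : ρ + (α + β) * δ₀ ≤ δ) (hcB : ∀ k ∈ s, 0 ≤ cB k)
    (hdnn : ∀ a b : g.Site, 0 ≤ g.dist a b) (htri : Triangle254 (toB6 g R H)) (hlen : ∀ y : g.Site, 0 < g.len y)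
    (h261 : Ineq261 d (toB6 g R H) δ₀ β)
    (hT1i : ScaleTransfer g δ₀ α Λ (fun a => (g.len a)⁻¹)) (hT2i : ScaleTransfer g δ₀ α Λ (fun a => (g.len a ^ 2)⁻¹))
    {G V C₃ : Module.End ℝ (W → ℝ)} {Dv B : K → Module.End ℝ (W → ℝ)} (hVdiv : V = ∑ k ∈ s, Dv k * B k + C₃)
    (hB : ∀ k ∈ s, HasL2Majorant (g := toB6 g R H) blk (B k)
      (fun a b => cB k * α₁ * (g.len a)⁻¹ * Real.exp (-(δ * g.dist a b))))
    (hC₃ : HasL2Majorant (g := toB6 g R H) blk C₃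
      (fun a b => cV * α₁ * (g.len a ^ 2)⁻¹ * Real.exp (-(δ * g.dist a b))))
    (hG : HasL2Majorant (g := toB6 g R H) blk G (fun a b => B₀ * g.len a * Real.exp (-(δ * g.dist a b))))
    (hGDv : ∀ k ∈ s, HasL2Majorant (g := toB6 g R H) blk (G * Dv k)
      (fun a b => B₀ * 1 * Real.exp (-(δ * g.dist a b)))) :
    HasL2Majorant (g := toB6 g R H) blk (G * V)
      (fun a b => (B₀ * Λ * B6.c1 d δ₀ β * (∑ k ∈ s, cB k + cV)) * α₁ * (g.len a)⁻¹ * Real.exp (-(ρ * g.dist a b))) := by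
  set c : ℝ := B6.c1 d δ₀ β with hc_def
  have hc0 : 0 ≤ c := B6RandomWalk.c1_nonneg d δ₀ β
  have hw1 : ∀ a : g.Site, 0 ≤ g.len a := fun a => (hlen a).le
  have hw2 : ∀ a : g.Site, 0 ≤ g.len a ^ 2 := fun a => sq_nonneg _
  have hw1i : ∀ a : g.Site, 0 ≤ (g.len a)⁻¹ := fun a => inv_nonneg.mpr (hlen a).le
  have hw2i : ∀ a : g.Site, 0 ≤ (g.len a ^ 2)⁻¹ := fun a => inv_nonneg.mpr (sq_nonneg _)
  have hcVα : 0 ≤ cV * α₁ := mul_nonneg hcV hα₁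
  have hρδ : ρ ≤ δ := by
    have : 0 ≤ (α + β) * δ₀ := by positivity
    linarith
  -- the word G′C₃
  have hC₃ρ := hasL2Majorant_rate_mono (R := R) (H := H) blk (cV * α₁) (fun a => (g.len a ^ 2)⁻¹) hcVα hw2i hρδ hdnn hC₃
  have w2 := hasL2Majorant_comp_decay (R := R) (H := H) blk d δ₀ α β ρ δ Λ B₀ (cV * α₁) (fun a => g.len a)
    (fun a => (g.len a ^ 2)⁻¹) hw1 hw2i hΛ hB₀ hcVα hρ hr hdnn htri hT2i h261 hG hC₃ρ
  -- the words (G′∇♯_k)B_k, summed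
  have w1k : ∀ k ∈ s, HasL2Majorant (g := toB6 g R H) blk (G * Dv k * B k)
      (fun a b => (cB k * α₁ * B₀ * Λ * c) * ((1 * (g.len a)⁻¹) * Real.exp (-(ρ * g.dist a b)))) := by
    intro k hk
    have hBρ := hasL2Majorant_rate_mono (R := R) (H := H) blk (cB k * α₁) (fun a => (g.len a)⁻¹)
      (mul_nonneg (hcB k hk) hα₁) hw1i hρδ hdnn (hB k hk)
    have h := hasL2Majorant_comp_decay (R := R) (H := H) blk d δ₀ α β ρ δ Λ B₀ (cB k * α₁) (fun _ => (1 : ℝ))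
      (fun a => (g.len a)⁻¹) (fun _ => zero_le_one) hw1i hΛ hB₀ (mul_nonneg (hcB k hk) hα₁) hρ hr hdnn htri hT1i h261
      (hGDv k hk) hBρ
    exact hasL2Majorant_mono (g := toB6 g R H) blk h fun a b => le_of_eq (by rw [← hc_def]; ring)
  have w1 := hasL2Majorant_sum_const (R := R) (H := H) blk s (fun k => cB k * α₁ * B₀ * Λ * c)
    (fun a b => (1 * (g.len a)⁻¹) * Real.exp (-(ρ * g.dist a b))) w1k
  have hsum' := hasL2Majorant_add (g := toB6 g R H) blk w1 w2
  have e : G * V = (∑ k ∈ s, G * Dv k * B k) + G * C₃ := by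
    rw [hVdiv]
    simp only [mul_add, Finset.mul_sum, mul_assoc]
  rw [e]
  refine hasL2Majorant_mono (g := toB6 g R H) blk hsum' fun a b => le_of_eq ?_
  have ha : g.len a ≠ 0 := (hlen a).ne'
  have h2 : g.len a * (g.len a ^ 2)⁻¹ = (g.len a)⁻¹ := by
    rw [pow_two, mul_inv, ← mul_assoc, mul_inv_cancel₀ ha, one_mul]
  rw [one_mul, h2, ← Finset.sum_mul, ← Finset.sum_mul, ← Finset.sum_mul, ← Finset.sum_mul, hc_def]
  ring


/-- **`∇_kG′(U)·V` FROM THE GRADIENT FORM AND THE COMMUTATOR LETTERS, IN ℓ²** (`divForm_of_gradForm_sum` + `B9Ineq363L2Right.hasL2Majorant_C₃_of_comm_sum_l2`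
BY NAME + §1's device). [cite: Balaban1985BackgroundPropagators, (3.46) p.398 + (3.61)–(3.63) p.402 + (3.70)–(3.73) pp.404–405 + (3.37) p.396 + p.403 l.1–9; Balaban1984PropagatorsII, Lemma 2.1 p.234 + Prop. 2.6 (2.140)–(2.141) p.247] -/
theorem hasL2Majorant_DGV_of_gradForm_comm_sum_l2 (blk : W → g.Site) (d : ℕ) (s : Finset K)
    (δ₀ δ α β ρ Λ B₀ cV α₁ : ℝ) (c1 cK : K → ℝ)
    (hB₀ : 0 ≤ B₀) (hcV : 0 ≤ cV) (hα₁ : 0 ≤ α₁) (hΛ : 0 ≤ Λ) (hρ : 0 ≤ ρ) (hα : 0 ≤ α) (hβ : 0 ≤ β) (hδ₀ : 0 ≤ δ₀)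
    (hr : ρ + (α + β) * δ₀ ≤ δ) (hc1 : ∀ k ∈ s, 0 ≤ c1 k) (hcK : ∀ k ∈ s, 0 ≤ cK k)
    (hdnn : ∀ a b : g.Site, 0 ≤ g.dist a b) (htri : Triangle254 (toB6 g R H)) (hlen : ∀ y : g.Site, 0 < g.len y)
    (h261 : Ineq261 d (toB6 g R H) δ₀ β)
    (hT1i : ScaleTransfer g δ₀ α Λ (fun a => (g.len a)⁻¹)) (hT2i : ScaleTransfer g δ₀ α Λ (fun a => (g.len a ^ 2)⁻¹))
    {G V V0 : Module.End ℝ (W → ℝ)} {V1 D : K → Module.End ℝ (W → ℝ)} (hVg : V = V0 + ∑ k ∈ s, V1 k * D k)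
    (hV0 : HasL2Majorant (g := toB6 g R H) blk V0
      (fun a b => cV * α₁ * (g.len a ^ 2)⁻¹ * Real.exp (-(δ * g.dist a b))))
    (hV1 : ∀ k ∈ s, HasL2Majorant (g := toB6 g R H) blk (V1 k)
      (fun a b => c1 k * α₁ * (g.len a)⁻¹ * Real.exp (-(δ * g.dist a b))))
    (hComm : ∀ k ∈ s, HasL2Majorant (g := toB6 g R H) blk (V1 k * D k - D k * V1 k)
      (fun a b => cK k * α₁ * (g.len a ^ 2)⁻¹ * Real.exp (-(δ * g.dist a b))))
    (hG : HasL2Majorant (g := toB6 g R H) blk G (fun a b => B₀ * g.len a * Real.exp (-(δ * g.dist a b))))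
    (hGD : ∀ k ∈ s, HasL2Majorant (g := toB6 g R H) blk (G * D k)
      (fun a b => B₀ * 1 * Real.exp (-(δ * g.dist a b)))) :
    HasL2Majorant (g := toB6 g R H) blk (G * V)
      (fun a b => (B₀ * Λ * B6.c1 d δ₀ β * (∑ k ∈ s, c1 k + (cV + ∑ k ∈ s, cK k))) * α₁ * (g.len a)⁻¹ *
        Real.exp (-(ρ * g.dist a b))) := by
  have hSK : 0 ≤ ∑ k ∈ s, cK k := Finset.sum_nonneg hcK
  have hC₃ := hasL2Majorant_C₃_of_comm_sum_l2 (R := R) (H := H) blk s δ cV α₁ cK hV0 hComm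
  exact hasL2Majorant_DGV_of_divForm_sum_l2 (R := R) (H := H) blk d s δ₀ δ α β ρ Λ B₀ (cV + ∑ k ∈ s, cK k) α₁ c1 hB₀
    (add_nonneg hcV hSK) hα₁ hΛ hρ hα hβ hδ₀ hr hc1 hdnn htri hlen h261 hT1i hT2i (divForm_of_gradForm_sum s hVg) hV1 hC₃ hG hGD

end Abstract

/-! ## §2  `∇_kG′(U)·V′(A)` in block-ℓ² form for the CONCRETE `V′(A)` of (3.60) -/

section Concrete

variable {𝔸 : Type*} [NormedRing 𝔸] [NormedAlgebra ℂ 𝔸] [CompleteSpace 𝔸] {ι : Type} [Fintype ι] [DecidableEq ι]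
variable (b : Module.Basis ι ℝ 𝔸) {S : Type} [Fintype S] [DecidableEq S] {κ : Type} [Fintype κ]
variable (T : κ → Equiv.Perm S) (U : κ → S → 𝔸ˣ)
variable {g : B9.Geometry} [Fintype g.Site] [DecidableEq g.Site] {Rr : ℝ} {H : Prop}

/-- ★ **THE LEFT COMPOSITE AT THE LETTER ∇, `∇_kG′(U)·V′(A)`, IN THE `L²` NORMS, FOR THE CONCRETE `V′(A)` OF (3.60)** (the factor of the MIXED member
(3.46)₄ of `G′(U′U)` in `∇G′(U′U)∇* = ∇G′(U)∇* + (∇G′(U)V′)·(G′(U′U)∇*)`, p. 403 l. 1–9): after real coordinates `∇_kG′(U)·conj b V′(A) ≺₂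
θ_R·(Lʲη)⁻¹·e^{−ρd}` with the SAME explicit `θ_R` as `B9Ineq363L2Right.hasL2Majorant_gp_vPrime`; inputs: the letter hypotheses of that theorem and
Theorem 3.1's members (3.46)₁ (`∇_kG′ ≺₂ B₀Lʲη e^{−δd}`) and (3.46)₄ (`∇_kG′∇♯_l ≺₂ B₀e^{−δd}`, all `l`) at U in ℓ².
[cite: Balaban1985BackgroundPropagators, (3.46) p.398 + (3.60)–(3.63) p.402 + (3.52) p.400 + (3.73) p.405 + (3.37) p.396 + p.398 (remarks) + p.403 l.1–9; Balaban1984PropagatorsII, Lemma 2.1 p.234 + Prop. 2.6 (2.140)–(2.141) p.247] -/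
theorem hasL2Majorant_dgp_vPrime (blk : S → g.Site) (d : ℕ) {η : ℝ} (hη : 0 < η) (A : κ → S → 𝔸)
    (kQ kF : g.Site → S → 𝔸 →L[ℝ] 𝔸) (sQ sF : S → 𝔸 →L[ℝ] 𝔸) (c w : g.Site → ℝ) (ρu d₀ M₂ C a₀ : ℝ)
    (δ₀ δ α β ρ Λ B₀ α₁ : ℝ)
    (hB₀ : 0 ≤ B₀) (hα₁ : 0 ≤ α₁) (hΛ : 0 ≤ Λ) (hρ : 0 ≤ ρ) (hα : 0 ≤ α) (hβ : 0 ≤ β) (hδ₀ : 0 ≤ δ₀) (hδ : 0 ≤ δ)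
    (hr : ρ + (α + β) * δ₀ ≤ δ)
    (hdnn : ∀ a a' : g.Site, 0 ≤ g.dist a a') (htri : Triangle254 (toB6 g Rr H)) (hlen : ∀ y : g.Site, 0 < g.len y)
    (h261 : Ineq261 d (toB6 g Rr H) δ₀ β)
    (hT1i : ScaleTransfer g δ₀ α Λ (fun a => (g.len a)⁻¹)) (hT2i : ScaleTransfer g δ₀ α Λ (fun a => (g.len a ^ 2)⁻¹))
    (hM₂ : 0 ≤ M₂) (hrepr : ∀ (v : 𝔸) (i : ι), |b.repr v i| ≤ M₂ * ‖v‖)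
    (hsmall : ∀ y : g.Site, η * (α₁ * (g.len y)⁻¹) ≤ 1 / 4)
    (hA : ∀ μ x, ‖A μ x‖ ≤ α₁ * (g.len (blk x))⁻¹ ∧ ‖tauB T U μ (A μ) x‖ ≤ α₁ * (g.len (blk x))⁻¹)
    (h337s : ∀ μ x, ‖((η : ℂ)⁻¹) • covDstar T U μ (A μ) x‖ ≤ α₁ * (g.len (blk x) ^ 2)⁻¹)
    (h337F : ∀ μ x, ‖((η : ℂ)⁻¹) • covD T U μ (A μ) x‖ ≤ α₁ * (g.len (blk x) ^ 2)⁻¹)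
    (h337B : ∀ μ x, ‖((η : ℂ)⁻¹) • covDstar T U μ (tauB T U μ (A μ)) x‖ ≤ α₁ * (g.len (blk x) ^ 2)⁻¹)
    (hρu : ∀ μ x, ‖((U μ x : 𝔸ˣ) : 𝔸)‖ ≤ ρu ∧ ‖(((U μ x)⁻¹ : 𝔸ˣ) : 𝔸)‖ ≤ ρu)
    (hd₀ : ∀ μ x, g.dist (blk x) (blk (T μ x)) ≤ d₀ ∧ g.dist (blk x) (blk ((T μ).symm x)) ≤ d₀)
    (hd₀0 : ∀ y : g.Site, g.dist y y ≤ d₀)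
    (hw : ∀ y, 0 ≤ w y) (hcard : ∀ y, ((B9Eq360Vprime.block blk y).card : ℝ) * w y ≤ 1) (hC : 0 ≤ C) (ha₀ : 0 ≤ a₀)
    (hkQ : ∀ y x, blk x = y → ‖kQ y x‖ ≤ w y) (hkF : ∀ y x, blk x = y → ‖kF y x‖ ≤ C * α₁ * w y)
    (hsQ : ∀ x, ‖sQ x‖ ≤ 1) (hsF : ∀ x, ‖sF x‖ ≤ C * α₁) (hc : ∀ y, |c y| ≤ a₀ * (g.len y ^ 2)⁻¹)
    {Gk : Module.End ℝ (S × ι → ℝ)}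
    (h346_1 : HasL2Majorant (g := toB6 g Rr H) (fun p : S × ι => blk p.1) Gk
      (fun a a' => B₀ * g.len a * Real.exp (-(δ * g.dist a a'))))
    (h346_4 : ∀ l : κ ⊕ κ, HasL2Majorant (g := toB6 g Rr H) (fun p : S × ι => blk p.1)
      (Gk * conj b (diffLetter T U ((η : ℂ)⁻¹) l)) (fun a a' => B₀ * 1 * Real.exp (-(δ * g.dist a a')))) :
    HasL2Majorant (g := toB6 g Rr H) (fun p : S × ι => blk p.1)
      (Gk * conj b (vPrimeConc T U η A blk kQ kF sQ sF c))
      (fun a a' => (B₀ * Λ * B6.c1 d δ₀ β *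
          (cVL2 (Fintype.card κ) (Fintype.card ι) ρu α₁ a₀ C M₂ (∑ i, ‖b i‖) (Real.sqrt (∑ i, ‖b i‖ ^ 2)) (Real.exp (δ * d₀)) +
            2 * Fintype.card κ * (2 * ρu ^ 2 * M₂ * (∑ i, ‖b i‖) * Real.sqrt ((1 * Fintype.card ι : ℕ) : ℝ) * Real.exp (δ * d₀)))) *
        α₁ * (g.len a)⁻¹ * Real.exp (-(ρ * g.dist a a'))) := by
  have hSb : 0 ≤ ∑ i, ‖b i‖ := Finset.sum_nonneg fun i _ => norm_nonneg _
  have hSb2 : 0 ≤ Real.sqrt (∑ i, ‖b i‖ ^ 2) := Real.sqrt_nonneg _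
  have hE₀ : 0 ≤ Real.exp (δ * d₀) := Real.exp_nonneg _
  have hd : (0 : ℝ) ≤ Fintype.card κ := Nat.cast_nonneg _
  -- the three constants: zeroth order (after coordinates), coefficients, commutators
  set c0L : ℝ := ((2 + 8 * ρu ^ 2 * α₁) * Fintype.card κ * M₂ * (∑ i, ‖b i‖) *
        Real.sqrt (((2 * Fintype.card κ + 1) * Fintype.card ι : ℕ) : ℝ) +
      a₀ * C * (2 + C * α₁) * M₂ * Real.sqrt (Fintype.card ι) * Real.sqrt (∑ i, ‖b i‖ ^ 2)) * Real.exp (δ * d₀) with hc0L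
  set c1L : ℝ := 2 * M₂ * (∑ i, ‖b i‖) * Real.sqrt ((1 * Fintype.card ι : ℕ) : ℝ) * Real.exp (δ * d₀) with hc1L
  set cKL : ℝ := 2 * ρu ^ 2 * M₂ * (∑ i, ‖b i‖) * Real.sqrt ((1 * Fintype.card ι : ℕ) : ℝ) * Real.exp (δ * d₀) with hcKL
  have hc0L0 : 0 ≤ c0L := by rw [hc0L]; positivity
  have hc1L0 : 0 ≤ c1L := by rw [hc1L]; positivity
  have hcKL0 : 0 ≤ cKL := by rw [hcKL]; positivity
  have hcV_eq : cVL2 (Fintype.card κ) (Fintype.card ι) ρu α₁ a₀ C M₂ (∑ i, ‖b i‖) (Real.sqrt (∑ i, ‖b i‖ ^ 2))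
      (Real.exp (δ * d₀)) = c0L + 2 * Fintype.card κ * c1L := by
    rw [cVL2, hc0L, hc1L]
  -- the zeroth-order part INCLUDING the averaging operator: (conj V⁰ − conj avgOp)
  have hV0 : HasL2Majorant (g := toB6 g Rr H) (fun p : S × ι => blk p.1)
      (conj b (V0op T U η A) - conj b (avgOp blk kQ kF sQ sF c))
      (fun y y' => c0L * α₁ * (g.len y ^ 2)⁻¹ * Real.exp (-(δ * g.dist y y'))) := by
    simpa only [hc0L] using
      hasL2Majorant_V0_vPrime b T U blk hη A kQ kF sQ sF c w ρu d₀ δ M₂ α₁ C a₀ hα₁ hδ hM₂ hrepr hlen hsmall hA h337s hρu hd₀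
        hd₀0 hw hcard hC ha₀ hkQ hkF hsQ hsF hc
  -- the operator identity: G′·conj V′ with conj V′ = Σ_k ∇_kV¹_k + ((V⁰ − avg) + Σ_k [V¹_k, ∇_k])
  have hVg : conj b (vPrimeConc T U η A blk kQ kF sQ sF c)
      = (conj b (V0op T U η A) - conj b (avgOp blk kQ kF sQ sF c))
        + ∑ k ∈ (Finset.univ : Finset (κ ⊕ κ)), conj b (coefLetter T U A k) * conj b (diffLetter T U ((η : ℂ)⁻¹) k) := by
    rw [vPrimeConc_eq, conj_sub, B9Eq352GradLetters.conj_V1pOp_eq_gradForm]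
    abel
  have h := hasL2Majorant_DGV_of_gradForm_comm_sum_l2 (R := Rr) (H := H) (fun p : S × ι => blk p.1) d
    (Finset.univ : Finset (κ ⊕ κ)) δ₀ δ α β ρ Λ B₀ c0L α₁ (fun _ => c1L) (fun _ => cKL) hB₀ hc0L0 hα₁ hΛ hρ hα hβ hδ₀ hr
    (fun _ _ => hc1L0) (fun _ _ => hcKL0) hdnn htri hlen h261 hT1i hT2i
    (V1 := fun k => conj b (coefLetter T U A k)) (D := fun k => conj b (diffLetter T U ((η : ℂ)⁻¹) k)) hVg hV0
    (fun k _ => by simpa only [hc1L] using hasL2Majorant_coefLetter b T U blk A d₀ δ M₂ α₁ hα₁ hδ hM₂ hrepr hlen hA hd₀0 k)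
    (fun k _ => by
      simpa only [hcKL] using
        hasL2Majorant_comm_coefLetter_diffLetter b T U blk η A ρu d₀ δ M₂ α₁ hα₁ hδ hM₂ hrepr h337F h337B hρu hd₀ k)
    h346_1 (fun k _ => h346_4 k)
  refine hasL2Majorant_mono (g := toB6 g Rr H) _ h fun a a' => le_of_eq ?_
  rw [Finset.sum_const, Finset.sum_const, Finset.card_univ, Fintype.card_sum, nsmul_eq_mul, nsmul_eq_mul, Nat.cast_add, hcV_eq]
  ring

end Concrete

/-! ## §3  The MIXED (3.46)-entry of `G′(U′U)` from the first form of (3.65): one product, no further walk -/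

section Extension

variable {g : B9.Geometry} [Fintype g.Site] {R : ℝ} {H : Prop} {W : Type} [Fintype W] [DecidableEq W]

omit [DecidableEq W] in
/-- ★★ **THE MIXED (3.46)-ENTRY `X·G′(U′U)·Y` OF `G′(U′U)`** (`X = ∇_k`, `Y = ∇♯_l`: the member `‖h∇_UG′(U′U)∇*_Uλ‖`, p. 403 l. 1–9): from the first form of
(3.65), `X·G′(U′U)·Y = X·G′(U)·Y + (X·G′(U)·V′(A))·(G′(U′U)·Y)`; so Theorem 3.1's mixed member at U (`X·G′(U)·Y ≺₂ B·e^{−δd}`), the left composite at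
the letter `X` (`X·G′(U)·V′ ≺₂ θ′(Lʲη)⁻¹e^{−δd}`, §2) and the RIGHT entry of `G′(U′U)` already obtained (`G′(U′U)·Y ≺₂ B′Lʲη e^{−ρd}`,
`B9Ineq363L2Right.hasL2Majorant_rightEntry_gpExt`) give `X·G′(U′U)·Y ≺₂ (B + θ′B′Λc₁(β))·e^{−ρd}` — one composition ([4] (2.52)–(2.55) in `L²`, the
y″-sum by Lemma 2.1, the weight `(Lʲη)⁻¹·Lʲη = 1` after one p. 398 transfer), no smallness beyond the right entry's.
[cite: Balaban1985BackgroundPropagators, (3.46) p.398 + p.398 (remarks) + (3.64)–(3.65) pp.402–403 + p.403 l.1–9; Balaban1984PropagatorsII, Lemma 2.1 p.234 + (2.52)–(2.55) p.232 + Prop. 2.6 (2.140)–(2.141) p.247] -/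
theorem hasL2Majorant_mixedEntry_gpExt (blk : W → g.Site) (d : ℕ) (δ₀ δ α β ρ Λ θ' B B' : ℝ)
    (hθ' : 0 ≤ θ') (hB : 0 ≤ B) (hB' : 0 ≤ B') (hΛ : 0 ≤ Λ) (hρ : 0 ≤ ρ) (hα : 0 ≤ α) (hβ : 0 ≤ β) (hδ₀ : 0 ≤ δ₀)
    (hr : ρ + (α + β) * δ₀ ≤ δ)
    (hdnn : ∀ a b : g.Site, 0 ≤ g.dist a b) (htri : Triangle254 (toB6 g R H)) (hlen : ∀ y : g.Site, 0 < g.len y)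
    (h261 : Ineq261 d (toB6 g R H) δ₀ β) (hT1 : ScaleTransfer g δ₀ α Λ (fun a => g.len a))
    {X GpU GpExt Vp Y : Module.End ℝ (W → ℝ)} (h365 : GpExt = GpU + GpU * (Vp * GpExt))
    (hXY : HasL2Majorant (g := toB6 g R H) blk (X * GpU * Y) (fun a b => B * 1 * Real.exp (-(δ * g.dist a b))))
    (hXM : HasL2Majorant (g := toB6 g R H) blk (X * GpU * Vp)
      (fun a b => θ' * (g.len a)⁻¹ * Real.exp (-(δ * g.dist a b))))
    (hRY : HasL2Majorant (g := toB6 g R H) blk (GpExt * Y) (fun a b => B' * g.len a * Real.exp (-(ρ * g.dist a b)))) :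
    HasL2Majorant (g := toB6 g R H) blk (X * GpExt * Y)
      (fun a b => (B + θ' * B' * Λ * B6.c1 d δ₀ β) * 1 * Real.exp (-(ρ * g.dist a b))) := by
  have hw1 : ∀ a : g.Site, 0 ≤ g.len a := fun a => (hlen a).le
  have hw1i : ∀ a : g.Site, 0 ≤ (g.len a)⁻¹ := fun a => inv_nonneg.mpr (hlen a).le
  have hρδ : ρ ≤ δ := by
    have : 0 ≤ (α + β) * δ₀ := by positivity
    linarith
  -- the operator identity from (3.65)₁
  have e : X * GpExt * Y = X * GpU * Y + X * GpU * Vp * (GpExt * Y) := by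
    conv_lhs => rw [h365]
    simp only [mul_add, add_mul, mul_assoc]
  -- the product word (X·G′(U)·V′)·(G′(U′U)·Y)
  have w2 := hasL2Majorant_comp_decay (R := R) (H := H) blk d δ₀ α β ρ δ Λ θ' B' (fun a => (g.len a)⁻¹) (fun a => g.len a)
    hw1i hw1 hΛ hθ' hB' hρ hr hdnn htri hT1 h261 hXM hRY
  -- the member at U, rate-lowered
  have w1 := hasL2Majorant_rate_mono (R := R) (H := H) blk B (fun _ => (1 : ℝ)) hB (fun _ => zero_le_one) hρδ hdnn hXY
  rw [e]
  refine hasL2Majorant_mono (g := toB6 g R H) blk (hasL2Majorant_add (g := toB6 g R H) blk w1 w2) fun a b => le_of_eq ?_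
  have ha : g.len a ≠ 0 := (hlen a).ne'
  have h1 : (g.len a)⁻¹ * g.len a = 1 := inv_mul_cancel₀ ha
  rw [h1]
  ring

end Extension

end Literature.MathematicalPhysics.QuantumFieldTheory.Balaban1983to89.B9Ineq363L2Mixed
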